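import Summits.AtomisticToContinuum.Crystallization.Theorems.PhononSlackCertificatesPeriodicGivenLayered

/-!
# Crux `TransitiveLocalLimit` (stmt-AtomisticToContinuum-15100), line `MotifTwo` — stub `stub_periodTwoHullPoint`

STUB 2 of the skeleton `Cruxes/TransitiveLocalLimit/Lines/MotifTwo.lean` (A PERIOD-TWO HULL POINT FROM
LAYERED WINDOWS): for a sequence `x` of Lennard-Jones ground states in `ℝ³` with layered windows at every
scale (one in-layer spacing `a ∈ [47/50, 1]`, free Hägg word, free interlayer gaps in `[39a/50, 17a/20]`, a
rigid motion per window, frequently in `N`), some FAULT-FREE (`s (m+1) = −s m`), EQUALLY SPACED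
(`z (m+2) − z (m+1) = z (m+1) − z m`) layered set `A(S(a, s, z))` lies in the hull of `x`: it is two-way
`ε`-matched on every ball `‖·‖ ≤ R` by translates of `x N`, frequently in `N`.

This is the internal endpoint of the landed chain of item stmt-AtomisticToContinuum-11779
(`Theorems/PhononSlackCertificatesPeriodicGivenLayered*.lean`, namespace `LayeredHull`) BEFORE the read-off
`pgl_readoff` packages the set as a `PeriodicConfiguration 3`; the proof is the first four steps of
`PeriodicGivenLayered_of` verbatim:

* `stub_extraction` — ONE exactly layered set `A(S(a, s, z))` in the hull (compactness of the window data and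
  a diagonal argument over the "frequently in `N`" windows);
* `stub_recurrence` — a layered set in the hull with UNIFORMLY RECURRENT data `(s', Δz')` (same `a`, same
  rigid motion `A`; minimal subsets of the shift-orbit closure);
* `stub_windowBounds`, `stub_registry`, `stub_convexity`, `stub_layerCake` — the window bounds (U)/(L), the
  registry facts, the increment convexity and the layer-cake bookkeeping;
* `stub_closing` — density closing: the recurrent set has no stacking fault and constant increments.

Shape of the statement: the layered set is a NAMED witness `S` together with its defining equation
`S = {p | ∃ m i j, p = A (i • t₁ + j • t₂ + L m • b + z m • e₃)}` (one-line registered stub signatures avoid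
`let … :=`); the `let`-bound forms in the `LayeredHull` theorems zeta-reduce to it, so the witness is
supplied by `rfl`.

[folklore]
-/

noncomputable section

namespace Summit.AtomisticToContinuum.Crystallization.Theorems.TransitiveLocalLimitMotifTwo

open Filter
open Literature.MathematicalPhysics.StatisticalMechanics
open Summit.AtomisticToContinuum.Crystallization.Theorems.LayeredHull

/-- **A period-two hull point from layered windows.** For a sequence `x` of Lennard-Jones ground states with
layered windows at every scale (common in-layer spacing `a ∈ [47/50, 1]`), some fault-free
(`s (m+1) = −s m`), equally spaced (`z (m+2) − z (m+1) = z (m+1) − z m`) layered set `A(S(a, s, z))` lies in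
the hull of `x` (two-way `ε`-matched on every ball by translates of `x N`, frequently in `N`).
Proof: `stub_extraction` → `stub_recurrence` → `stub_closing` (fed by `stub_windowBounds`, `stub_registry`,
`stub_convexity`, `stub_layerCake`), exactly as in `PeriodicGivenLayered_of` but stopping before
`pgl_readoff`; the named set `S` is the `let`-bound set of `stub_recurrence`, by `rfl`. [folklore] -/
theorem stub_periodTwoHullPoint : ∀ x : (N : ℕ) → (Fin N → EuclideanSpace ℝ (Fin 3)), (∀ N, IsGroundState lennardJones (x N)) → ∀ a : ℝ, 47 / 50 ≤ a → a ≤ 1 → (∀ R ε : ℝ, 0 < ε → ∃ᶠ N in atTop, ∃ (A : EuclideanSpace ℝ (Fin 3) →ₗᵢ[ℝ] EuclideanSpace ℝ (Fin 3)) (t : EuclideanSpace ℝ (Fin 3)) (s : ℤ → ℤ) (z : ℤ → ℝ), IsHaggSeq s ∧ (∀ m : ℤ, 39 / 50 * a ≤ z (m + 1) - z m ∧ z (m + 1) - z m ≤ 17 / 20 * a) ∧ ((∀ p ∈ {p : EuclideanSpace ℝ (Fin 3) | ∃ m i j : ℤ, p = A (((i : ℝ) • triangularVec₁ a) + ((j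 : ℝ) • triangularVec₂ a) + ((haggLabel s m : ℝ) • barlowOffset a) + (z m • layerNormal 1))}, ‖p‖ ≤ R → ∃ i : Fin N, dist (x N i + t) p ≤ ε) ∧ (∀ i : Fin N, ‖x N i + t‖ ≤ R → ∃ p ∈ {p : EuclideanSpace ℝ (Fin 3) | ∃ m i j : ℤ, p = A (((i : ℝ) • triangularVec₁ a) + ((j : ℝ) • triangularVec₂ a) + ((haggLabel s m : ℝ) • barlowOffset a) + (z m • layerNormal 1))}, dist (x N i + t) p ≤ ε))) → ∃ (A : EuclideanSpace ℝ (Fin 3) →ₗᵢ[ℝ] EuclideanSpace ℝ (Fin 3)) (s : ℤ → ℤ) (z : ℤ → ℝ) (S : Set (EuclideanSpace ℝ (Fin 3))), S = {p : EuclideanSpace ℝ (Fin 3) | ∃ m i j : ℤ, p = A (((i : ℝ) • triangularVec₁ a) + ((j : ℝ) • triangularVec₂ a) + ((haggLabel s m : ℝ) • barlowOffset a) + (z m • layerNormal 1))} ∧ IsHaggSeq s ∧ (∀ m : ℤ, 39 / 50 * a ≤ z (m + 1) - z m ∧ z (m + 1) - z m ≤ 17 / 20 * a) ∧ (∀ m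 : ℤ, s (m + 1) = -s m) ∧ (∀ m : ℤ, z (m + 2) - z (m + 1) = z (m + 1) - z m) ∧ ∀ R ε : ℝ, 0 < ε → ∃ᶠ N in atTop, ∃ t : EuclideanSpace ℝ (Fin 3), (∀ p ∈ S, ‖p‖ ≤ R → ∃ i : Fin N, dist (x N i + t) p ≤ ε) ∧ (∀ i : Fin N, ‖x N i + t‖ ≤ R → ∃ p ∈ S, dist (x N i + t) p ≤ ε) := by
  intro x hx a ha ha1 hW
  -- (1) one layered set in the hull
  obtain ⟨A, s, z, hs, hz, hH⟩ := stub_extraction x a ha ha1 hW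
  -- (2) a uniformly recurrent layered set in the hull (same `a`, same `A`)
  obtain ⟨s', z', hs', hz', hrec, hH'⟩ := stub_recurrence x a ha ha1 A s z hs hz hH
  -- (3)–(7) the recurrent set is fault-free and equally spaced
  obtain ⟨hU, hL⟩ := stub_windowBounds
  obtain ⟨hfault, hconst⟩ := stub_closing x hx a ha ha1 A s' z' hs' hz' hrec hH' hU hL stub_registry
    stub_convexity stub_layerCake
  exact ⟨A, s', z', _, rfl, hs', hz', hfault, hconst, hH'⟩

end Summit.AtomisticToContinuum.Crystallization.Theorems.TransitiveLocalLimitMotifTwo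

end
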